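import Literature.NumberTheory.EllipticCurves.BurungaleCastellaSkinner2025.TwoVariableMainTheorem
import Literature.NumberTheory.EllipticCurves.YanZhu2026.GreenbergDivisibilityProofs
import HarnessLib

/-!
# Burungale–Castella–Skinner 2025, Thm. 1.4.1 (a) ("in `Λ_K ⊗ ℚ_p`") made INTEGRAL on the divisibility
# `ch(X^ord) ⊂ (L_p^PR)` by `μ(L_p^Gr(E/K)⁻) = 0` (Prop. 4.2.2) and the ord/Gr equivalence — without (sur)
# (proofs only)

`Proofs` companion (theorems only: no definition, no named fact, no instance) of
`TwoVariableMainTheorem.lean` (seat `bsd-littype-03`, gen 2: the named fact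
`thm141_XOrd₂_isTorsion_charIdeal_eq_perrinRiou` = [BCS25, Thm. 1.4.1] and its rational currency
`IdealLeSpanRat`) and of `YanZhu2026/GreenbergDivisibilityProofs.lean` §E (seat `bsd-littype-04`, gen 5:
"rational ⟹ integral when `μ(G⁻) = 0`").

A. Burungale, F. Castella, C. Skinner, IMRN 2025 rnaf082 = arXiv:2405.00270v2. Thm. 1.4.1 (p. 4): under
(irr_ℚ), `p > 3`, (disc), (Heeg), (spl), `V = ∅`: (a) `ch_{Λ_K}(X^ord(E/K_∞)) = (L_p^PR(E/K))` in
`Λ_K ⊗ ℚ_p`; (b) under (sur) the equality holds in `Λ_K`. Prop. 4.2.2 (p. 9): under (disc), (Heeg), (spl),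
(irr_K), `μ(L_p^Gr(g/K)) = μ(L_p^BDP(g/K)) = 0`. Proof of Prop. 5.2.1 (p. 10): "Since `μ(…) = 0` by
Proposition 4.2.2, the divisibility (5.1) holds integrally". [YZ26] Thm. 4.7 (the `S`-localised ord ⟺ Gr
equivalence; tree `YanZhu2026.thm47_…AnyRoot…`).

WHAT IS PROVED.
* `IwasawaAlgebra₂.idealLeSpanAway_natCast_of_idealLeSpanRat` — the two rational currencies agree:
  `IdealLeSpanRat J L` ("for every `g ∈ J` some `pᵃ g ∈ L·Λ_K`", exponent depending on `g`) implies
  `IdealLeSpanAway p J L` (ONE exponent for all of `J`), because `Λ_K = ℤ_p⟦T₁⟧⟦T₂⟧` is noetherian (take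
  the maximum over a finite generating set); and conversely (`idealLeSpanRat_of_idealLeSpanAway_natCast`).
* `exists_idealLeSpan_of_thm141_of_thm47_of_hasUnitContent_minus` — granted `thm141_…` (BCS Thm. 1.4.1)
  and `thm47_…AnyRoot…` (YZ Thm. 4.7): under `GreenbergSetting`, `p > 3`, (irr_ℚ), (irr_K), (Heeg), `V = ∅`,
  for a Katz/Greenberg frame `(LK, G)` with `μ(G⁻) = 0` and a compatible `J`, the type-I frame `F` of
  Thm. 1.4.1 satisfies the INTEGRAL `ch(X^ord) ⊂ (L_p^PR)` (`IdealLeSpan`) and `ch(X_Gr)·𝒪 ⊆ (G)` — i.e. the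
  divisibility half of Thm. 1.4.1 (b)'s conclusion WITHOUT (sur); with `μ(G⁻) = 0` discharged by Prop.
  4.2.2 (`hasUnitContent_minus_of_prop314AnyRoot_of_prop422`):
  `exists_idealLeSpan_of_thm141_of_thm47_of_prop314_of_prop422`.
This is a kernel DERIVATION from refereed named facts (a cross-paper consistency edge with [YZ26, Thm.
4.2 (1)], whose printed statement has the same integral divisibility under absolute irreducibility and
Heegner); it is NOT printed in [BCS25] as a statement and asserts nothing new about the sources.

## References
* [BurungaleCastellaSkinner2025] arXiv:2405.00270v2: Thm. 1.4.1 (p. 4), Prop. 4.2.2 (p. 9), proof of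
  Prop. 5.2.1 (p. 10, "holds integrally").
* [YanZhu2024MainConjNonCM] arXiv:2412.20078v4: Thm. 4.7 (l.1022–1034), proof of Thm. 4.2 (2)
  (l.1042–1050).
-/

noncomputable section

open scoped Classical

open PowerSeries NumberField IsDedekindDomain Field CongruenceSubgroup
  Literature.NumberTheory.GaloisRepresentations Literature.NumberTheory.EllipticCurves
  Literature.NumberTheory.EllipticCurves.ModularForms Literature.NumberTheory.EllipticCurves.Rank1Residual
  Literature.NumberTheory.EllipticCurves.UnrSeries₂ Literature.NumberTheory.EllipticCurves.GreenbergVatsal2000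

/-! ## §1. `IdealLeSpanRat ↔ IdealLeSpanAway p` (uniform exponent by noetherianity of `Λ_K`) -/

namespace Literature.NumberTheory.EllipticCurves.IwasawaAlgebra₂

variable {p : ℕ} [Fact p.Prime]

/-- `S = {pⁿ}`-localised inclusion ⟹ the pointwise rational inclusion (take `a = n` for every `g`).
[cite: BurungaleCastellaSkinner2025, Thm. 1.4.1 (a) ("in Λ_K ⊗ ℚ_p", p. 4 of arXiv:2405.00270v2)] -/
theorem idealLeSpanRat_of_idealLeSpanAway_natCast {J : Ideal (IwasawaAlgebra₂ p)} {L : CycAntiSeries p}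
    (h : IdealLeSpanAway (p : IwasawaAlgebra₂ p) J L) : IdealLeSpanRat J L := by
  obtain ⟨n, hn⟩ := h
  intro g hg
  obtain ⟨h, hh⟩ := hn g hg
  exact ⟨n, h, hh⟩

/-- **The pointwise rational inclusion `IdealLeSpanRat J L` implies the uniform one
`IdealLeSpanAway p J L`**: `Λ_K = ℤ_p⟦T₁⟧⟦T₂⟧` is noetherian, so `J` is finitely generated and the
maximum of the exponents of a generating set serves for all of `J` (the property "`pⁿ g ∈ L·Λ_K` through
`toCycAnti`" is stable under the `Λ_K`-span operations). So [BCS25]'s "in `Λ_K ⊗ ℚ_p`" and [YZ26, Thm.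
4.7]'s "`S⁻¹`, `S = {pⁿ}`" are the same statement.
[cite: BurungaleCastellaSkinner2025, Thm. 1.4.1 (a) ("in Λ_K ⊗ ℚ_p", p. 4 of arXiv:2405.00270v2)]
[cite: YanZhu2024MainConjNonCM, Thm. 4.7 (S⁻¹-localised inclusions, arXiv:2412.20078v4 TeX l.1022–1034)] -/
theorem idealLeSpanAway_natCast_of_idealLeSpanRat {J : Ideal (IwasawaAlgebra₂ p)} {L : CycAntiSeries p}
    (h : IdealLeSpanRat J L) : IdealLeSpanAway (p : IwasawaAlgebra₂ p) J L := by
  -- a finite generating set of `J`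
  have hJ : J.FG := (isNoetherianRing_iff_ideal_fg (IwasawaAlgebra₂ p)).1 inferInstance J
  obtain ⟨s, hs⟩ := hJ
  -- exponents on the generators
  have hgen : ∀ g ∈ s, ∃ (a : ℕ) (h : IwasawaAlgebra₂ p),
      toCycAnti p ((p : IwasawaAlgebra₂ p) ^ a * g) = L * toCycAnti p h :=
    fun g hg ↦ h g (hs ▸ Ideal.subset_span hg)
  choose a hh hah using hgen
  -- the uniform exponent
  refine ⟨s.sup fun g ↦ if hg : g ∈ s then a g hg else 0, fun g hg ↦ ?_⟩
  set n : ℕ := s.sup fun g ↦ if hg : g ∈ s then a g hg else 0 with hn_def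
  rw [← hs] at hg
  induction hg using Submodule.span_induction with
  | mem x hx =>
    have hx' : x ∈ s := Finset.mem_coe.mp hx
    have hle : a x hx ≤ n := by
      have h1 := Finset.le_sup (f := fun g ↦ if hg : g ∈ s then a g hg else 0) hx'
      simp only [dif_pos hx'] at h1
      exact h1
    refine ⟨(p : IwasawaAlgebra₂ p) ^ (n - a x hx) * hh x hx, ?_⟩
    rw [show (p : IwasawaAlgebra₂ p) ^ n * x =
        (p : IwasawaAlgebra₂ p) ^ (n - a x hx) * ((p : IwasawaAlgebra₂ p) ^ a x hx * x) by
      rw [← mul_assoc, ← pow_add, Nat.sub_add_cancel hle], map_mul, hah x hx, map_mul]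
    ring
  | zero => exact ⟨0, by simp⟩
  | add x y _ _ hx hy =>
    obtain ⟨h₁, h₁eq⟩ := hx
    obtain ⟨h₂, h₂eq⟩ := hy
    exact ⟨h₁ + h₂, by rw [mul_add, map_add, h₁eq, h₂eq, map_add, mul_add]⟩
  | smul r x _ hx =>
    obtain ⟨h₁, h₁eq⟩ := hx
    refine ⟨r * h₁, ?_⟩
    rw [smul_eq_mul, mul_left_comm, map_mul, h₁eq, map_mul]
    ring

end Literature.NumberTheory.EllipticCurves.IwasawaAlgebra₂

/-! ## §2. Thm. 1.4.1 (a) + Thm. 4.7 + `μ(G⁻) = 0` ⟹ the integral divisibilities, without (sur) -/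

namespace Literature.NumberTheory.EllipticCurves.BurungaleCastellaSkinner2025

open IwasawaAlgebra₂ YanZhu2026

variable {p : ℕ} [Fact p.Prime]

/-- **[BCS25, Thm. 1.4.1 (a)] made integral on its divisibility half by `μ(G⁻) = 0`** — granted
`thm141_…` and [YZ26, Thm. 4.7] (`thm47_…AnyRoot…`): under `GreenbergSetting ι W N K 𝔭 𝔭̄ κ₁ κ₂`, `p > 3`,
(irr_ℚ), (irr_K), (Heeg), `V = ∅`, for every Katz/Greenberg frame `(LK, G)` at `(γ₁⁻¹, γ₂⁻¹)` with
`HasUnitContent (minus G)` and every compatible `J`, the type-I frame `F` of Thm. 1.4.1 (the embedding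
`ι₁ : ℤ̄ → ℂ_p` compatible with `ι`) has `IdealLeSpan (ch(X^ord)) (L_p^PR)` in `Λ_K` and
`ch(X_Gr)·𝒪_{ℂ_p}⟦T₁,T₂⟧ ⊆ (G)`. Route: Thm. 1.4.1 (a) `IdealLeSpanRat` ⟹ `IdealLeSpanAway p`
(noetherianity) ⟹ §E of `GreenbergDivisibilityProofs` (Thm. 4.7 at `S = {pⁿ}`, cancellation of `pⁿ`,
Thm. 4.7 at `S = {1}`). (sur) is NOT assumed; nothing is asserted about the equality.
[cite: BurungaleCastellaSkinner2025, Thm. 1.4.1 (a) (p. 4 of arXiv:2405.00270v2) and proof of Prop. 5.2.1 (p. 10, "holds integrally")]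
[cite: YanZhu2024MainConjNonCM, Thm. 4.7 (arXiv:2412.20078v4 TeX l.1022–1034)] -/
theorem exists_idealLeSpan_of_thm141_of_thm47_of_hasUnitContent_minus
    (h141 : thm141_XOrd₂_isTorsion_charIdeal_eq_perrinRiou)
    (h47 : thm47_ord_localised_iff_greenbergAnyRoot_localised)
    (ι₁ : integralClosure ℚ ℂ →+* ℂ_[p]) (ι : PadicAlgCl p ≃+* ℂ) (W : WeierstrassCurve ℚ) [W.IsElliptic]
    [W.IsGloballyMinimal] (K : Type) [Field K] [NumberField K] (v vbar : HeightOneSpectrum (𝓞 K))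
    (κ₁ κ₂ : ZpExtension K p) (γ₁ γ₂ : absoluteGaloisGroup K)
    [Fact (ZpExtension.IsTopGeneratorPair κ₁ κ₂ γ₁ γ₂)] {N : ℕ} [NeZero N]
    (π : ModularParametrizationData W N) [NeZero (NumberField.discr K).natAbs]
    (hset : GreenbergSetting ι W N K v vbar κ₁ κ₂) (hp : 3 < p) (hIrr : Irr W p)
    (hirr : (W.baseChange K).HasIrreducibleModPGaloisRep p) (hH : SatisfiesHeegnerHypothesis N K)
    (hV : vexingPrimes W p = ∅)
    (hι : ∀ z : integralClosure ℚ ℂ, ι₁ z = ((ι.symm (z : ℂ) : PadicAlgCl p) : ℂ_[p]))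
    {Ω δ : ℂ} {Ωp : (unrIntegers p)ˣ} {LK G : PowerSeries (PowerSeries (PadicComplexInt p))}
    (hLK : IsKatzMeasure₂ ι v vbar ∅ κ₁ κ₂ γ₁⁻¹ γ₂⁻¹ 1 Ω δ ((Ωp : unrIntegers p) : ℂ_[p]) LK)
    (hG : IsGreenbergLFunctionAnyRoot₂ ι v vbar κ₁ κ₂ γ₁⁻¹ γ₂⁻¹ π.f (NumberField.discr K).natAbs
      (NumberField.classNumber K) LK G)
    (J : ℤ_[p] →+* PadicComplexInt p)
    (hJ : ∀ x : ℤ_[p], ((J x : PadicComplexInt p) : ℂ_[p]) = ((x : ℚ_[p]) : ℂ_[p]))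
    (hμ : HasUnitContent (minus G)) :
    ∃ F : CycAntiSeries p, IsHidaRankinLFunction ι₁ W κ₁ κ₂ π.f F ∧ IsCongruenceIntegral π.f F ∧
      IdealLeSpan (WeierstrassCurve.XOrd₂.charIdeal (W.baseChange K) p κ₁ κ₂ γ₁ γ₂)
          (perrinRiouLFunction W π F) ∧
        (WeierstrassCurve.XGr₂.charIdeal (W.baseChange K) p κ₁ κ₂ vbar γ₁ γ₂).map (toUnr₂ p J) ≤
          Ideal.span {G} := by
  obtain ⟨F, hF, hcF, -, ⟨hrat, -⟩, -⟩ := h141 ι₁ W K κ₁ κ₂ γ₁ γ₂ π hp hset.goodOrd hIrr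
    hset.isImaginaryQuadratic hH hset.split hset.discr_odd hset.discr_ne hV
  exact ⟨F, hF, hcF, idealLeSpan_and_charIdealXGr₂_map_le_span_of_rational_of_thm47_of_hasUnitContent_minus
    h47 ι₁ ι W K v vbar κ₁ κ₂ γ₁ γ₂ π hset hirr hι hF hcF hLK hG J hJ hμ
    (idealLeSpanAway_natCast_of_idealLeSpanRat hrat)⟩

/-- **The same with `μ(G⁻) = 0` discharged by Prop. 4.2.2** (`prop422_…` + [YZ26, Prop. 3.14]
`prop314_…_anyRoot`, via `hasUnitContent_minus_of_prop314AnyRoot_of_prop422`): granted the four refereed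
facts, under `GreenbergSetting`, `p > 3`, (irr_ℚ), (irr_K), (Heeg), `V = ∅`, for every Katz/Greenberg
frame and compatible `J`, the type-I frame of Thm. 1.4.1 has the INTEGRAL `ch(X^ord) ⊂ (L_p^PR)` and
`ch(X_Gr)·𝒪 ⊆ (G)` — no (sur).
[cite: BurungaleCastellaSkinner2025, Thm. 1.4.1 (a) (p. 4), Prop. 4.2.2 (p. 9) and proof of Prop. 5.2.1 (p. 10) of arXiv:2405.00270v2]
[cite: YanZhu2024MainConjNonCM, Thm. 4.7 (l.1022–1034) and Prop. 3.14 (l.896–903) of arXiv:2412.20078v4] -/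
theorem exists_idealLeSpan_of_thm141_of_thm47_of_prop314_of_prop422
    (h141 : thm141_XOrd₂_isTorsion_charIdeal_eq_perrinRiou)
    (h47 : thm47_ord_localised_iff_greenbergAnyRoot_localised)
    (h314 : prop314_span_minus_eq_span_bdp_anyRoot) (h422 : prop422_exists_isBDPLFunction_mu_eq_zero)
    (ι₁ : integralClosure ℚ ℂ →+* ℂ_[p]) (ι : PadicAlgCl p ≃+* ℂ) (W : WeierstrassCurve ℚ) [W.IsElliptic]
    [W.IsGloballyMinimal] (K : Type) [Field K] [NumberField K] (v vbar : HeightOneSpectrum (𝓞 K))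
    (κ₁ κ₂ : ZpExtension K p) (γ₁ γ₂ : absoluteGaloisGroup K)
    [Fact (ZpExtension.IsTopGeneratorPair κ₁ κ₂ γ₁ γ₂)] {N : ℕ} [NeZero N]
    (π : ModularParametrizationData W N) [NeZero (NumberField.discr K).natAbs]
    (hset : GreenbergSetting ι W N K v vbar κ₁ κ₂) (hp : 3 < p) (hIrr : Irr W p)
    (hirr : (W.baseChange K).HasIrreducibleModPGaloisRep p) (hH : SatisfiesHeegnerHypothesis N K)
    (hV : vexingPrimes W p = ∅)
    (hι : ∀ z : integralClosure ℚ ℂ, ι₁ z = ((ι.symm (z : ℂ) : PadicAlgCl p) : ℂ_[p]))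
    {Ω δ : ℂ} {Ωp : (unrIntegers p)ˣ} {LK G : PowerSeries (PowerSeries (PadicComplexInt p))}
    (hLK : IsKatzMeasure₂ ι v vbar ∅ κ₁ κ₂ γ₁⁻¹ γ₂⁻¹ 1 Ω δ ((Ωp : unrIntegers p) : ℂ_[p]) LK)
    (hG : IsGreenbergLFunctionAnyRoot₂ ι v vbar κ₁ κ₂ γ₁⁻¹ γ₂⁻¹ π.f (NumberField.discr K).natAbs
      (NumberField.classNumber K) LK G)
    (J : ℤ_[p] →+* PadicComplexInt p)
    (hJ : ∀ x : ℤ_[p], ((J x : PadicComplexInt p) : ℂ_[p]) = ((x : ℚ_[p]) : ℂ_[p])) :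
    ∃ F : CycAntiSeries p, IsHidaRankinLFunction ι₁ W κ₁ κ₂ π.f F ∧ IsCongruenceIntegral π.f F ∧
      IdealLeSpan (WeierstrassCurve.XOrd₂.charIdeal (W.baseChange K) p κ₁ κ₂ γ₁ γ₂)
          (perrinRiouLFunction W π F) ∧
        (WeierstrassCurve.XGr₂.charIdeal (W.baseChange K) p κ₁ κ₂ vbar γ₁ γ₂).map (toUnr₂ p J) ≤
          Ideal.span {G} :=
  exists_idealLeSpan_of_thm141_of_thm47_of_hasUnitContent_minus h141 h47 ι₁ ι W K v vbar κ₁ κ₂ γ₁ γ₂ π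
    hset hp hIrr hirr hH hV hι hLK hG J hJ
    (hasUnitContent_minus_of_prop314AnyRoot_of_prop422 h314 h422 ι W K v vbar κ₁ κ₂ γ₁ γ₂
      π.isNewformOf hset hH hirr hLK hG)

end Literature.NumberTheory.EllipticCurves.BurungaleCastellaSkinner2025

end
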